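import Literature.MathematicalPhysics.QuantumFieldTheory.Balaban1983to89.B4BoxCov237
import Literature.MathematicalPhysics.QuantumFieldTheory.Balaban1983to89.Beta.CombesThomasFormOp

/-!
# `Balaban1983to89.B4Lower18` — B4 (1.8), the strictly positive lower bound `−Δ^{η,N}_{A,Ω} + aP_k(A) ≥ γ₀I`, in
the case `A = 0`, for EVERY finite region `Ω` that is a union of blocks (Neumann boundary conditions), with the
explicit `η`-, `Ω`-, `d`-free constant `γ₀ = min(2, a)`; hence the invertibility behind (1.6) (`m² ≥ 0`, indeed
`m² > −min(2,a)`); the quadratic form of the operator of (1.6) = (1.3) + `m²` + `a`·(1.5) (the dictionary,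
kernel-checked); and the `η`-, `Ω`-uniform Combes–Thomas set-to-set and kernel decay of `G_k(Ω, 0)` (an `L²` bound of
the exponential type of (1.10) — NOT the printed pointwise `‖·‖_∞` statement (1.10)).  HYPOTHESIS-FREE (a sibling of
`B4BoxCov237`, which did the boxes; no existing module is touched; nothing of B4 is asserted).

Source under audit (cell pub-balaban): T. Bałaban, *Regularity and decay of lattice Green's functions*, Commun. Math.
Phys. **89** (1983) 571–597 [`Balaban1983RegularityDecay`, "B4"], p. 572 [PDF 2] (1.1), (1.3)–(1.6) and the two
framing sentences, p. 573 [PDF 3] (1.8) and (1.10) (journal page = PDF page + 570; renders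
`b2b-balaban-ref1/pages/1983-cmp89-regularity-decay/1983-cmp89-regularity-decay-p002-x2.png`, `-p003-x2.png`, read as
images).

## WHAT IS PRINTED (verbatim; `≦` of the print written `≤`)

p. 572: «The lattice ηZ^d is divided into unit cubes called blocks and parametrized by points y of the unit lattice
Z^d: B^k(y) = Δ(y) = {x∈ηZ^d : y_μ ≤ x_μ < y_μ + 1, μ = 1, …, d},  y∈Z^d.   (1.1)  We consider also a second division
of ηZ^d into cubes of size M called big blocks. … We consider subsets Ω which are unions of big blocks.» … «Now the
covariant Laplace operator −Δ^{η,N}_{A,Ω} on a domain Ω with Neumann boundary conditions on ∂Ω is given by the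
following quadratic form defined on functions φ : Ω→R^N
⟨φ,(−Δ^{η,N}_{A,Ω})φ⟩ = Σ_{b⊂Ω} η^d|(D^η_Aφ)(b)|² = Σ_{b⊂Ω} η^d|η^{−1}(U(A_b)φ(b₊) − φ(b₋))|²,   (1.3)
where the summation is over the set of all bonds b = ⟨b₋, b₊⟩ with end-points b₋, b₊ in Ω.» … «(Q_k(A)φ)(y) =
Σ_{x∈B^k(y)} η^dU(A(Γ^{(k)}_{y,x}))φ(x),  y∈Z^d.   (1.4)» … «The projection operator P_k(A) is given by
P_k(A) = Q_k^*(A)Q_k(A).   (1.5)  Our fundamental Green's function is a kernel of the operator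
G_k(Ω, A) = (−Δ^{η,N}_{A,Ω} + m² + aP_k(A))^{−1},   (1.6)  where m² ≥ 0 and a is a positive constant close to 1.»

p. 573: «The operator defining the Green's function (1.6) has a strictly positive lower bound. More exactly we prove
that there exists a positive constant γ₀ such that for e sufficiently small and for a regular vector field A
−Δ^{η,N}_{A,Ω} + aP_k(A) ≥ γ₀I.   (1.8)
The constant γ₀ is independent of the lattice spacing η, as well as of Ω and of A. This bound justifies the definition
(1.6) and explains exponential decay properties.» … (in the Theorem, «Proposition 2.1 of [1]») «Similarly
|(D^η_{A,μ}G_k(Ω, A)f)(x)|, |(G_k(Ω, A)(x)| ≤ c₀ exp(−δ₀ dist(x, supp f))‖f‖_∞   (1.10)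
for x∈Ω, dist(x, Ω^c) ≥ R₀.»

## WHAT THIS FILE CERTIFIES (kernel-checked, no hypotheses; the lineage is USED, not re-proved)

Throughout `A = 0` (so `U ≡ 1`), spatial dimension `d + 1` (the paper's `d`), mesh `η = 1/n` with ANY `n ≥ 1` (the
paper's `n = L^k`), everything in LATTICE UNITS: fine points `x ∈ ℤ^{d+1} = η^{-1}(ηℤ^{d+1})`, the block of `x` labelled
by `blk n x ∈ ℤ^{d+1}` (`B4Green242Bridge.blk`, = the `y` of (1.1)), a REGION `R ⊂ ℤ^{d+1}` = `η^{-1}Ω` any finite set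
closed under «same block» (`IsBlockUnion n R`, §1; `fineDom n Ω` = the union of the blocks labelled by a finite
`Ω ⊂ ℤ^{d+1}` is one, and so is every fine box `boxDom (n·M)`).  The operator of (1.6) at `A = 0` in the counting basis
of `ℝ^R` is the matrix (§2) `fineOpR n a m² R = n²(−Δ^N_R) + m²·1 + (a/n^{d+1})·1_{same block}`, `−Δ^N_R` the graph
Laplacian of `R` with the nearest-neighbour bonds having both end-points in `R` (Neumann), and (§7, `fineOpR_form`)
ITS QUADRATIC FORM IS THE PRINTED ONE:
`⟨g, fineOpR g⟩ = (n²/2)Σ_{x,y∈R, y~x}(g(x) − g(y))² + m²‖g‖² + (a/n^{d+1})Σ_b(Σ_{x∈b} g(x))²`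
= `η^{-(d+1)}`·[(1.3) + `m²⟨φ,φ⟩` + `a‖Q_k(0)φ‖²`] under the dictionary below (`φ = g`).  Then:

* (§6, `lower18_zero`, `lower18`, `ineq18_A0`) **(1.8) at `A = 0` with `γ₀ = min(2, a)`**: for every `a ≥ 0`,
  `n ≥ 1`, every finite union `R` of blocks and every `g : R → ℝ`,
  `min(2,a)·‖g‖² ≤ ⟨g, (n²(−Δ^N_R) + (a/n^{d+1})1_{same block}) g⟩`, and with the mass
  `(min(2,a) + m²)‖g‖² ≤ ⟨g, fineOpR n a m² R g⟩`; `ineq18_A0` packages it in the printed quantifier order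
  («there exists a positive constant γ₀ … independent of η, as well as of Ω»: `∃ γ₀ > 0, ∀ d n Ω g, …`, `γ₀ = min 2 a`).
* (§6, `fineOpR_coercive`, `fineOpR_isUnit`, `fineOpR_mul_inv`, `fineOpR_inv_mul`) «This bound justifies the
  definition (1.6)»: for `min(2,a) + m² > 0` (in particular `a > 0`, `m² ≥ 0`) the matrix is invertible, so
  `G_k(Ω, 0) = (fineOpR n a m² R)⁻¹` is a genuine two-sided inverse; `green_entry_le`: `|G(x,t)| ≤ (min(2,a) + m²)⁻¹`.
* (§6, `boxOpR_form_ge`, `fineOpR_boxDom`) the box case: `fineOpR n a m² (boxDom (n·M)) = B4BoxCov237.boxOpR n a m² M`,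
  so the sibling's fine Neumann box operator inherits the bound `min(2,a) + m²`.
* (§8, `setDecay_region`, `green_setDecay_region`, `green_entry_decay_region`) «explains exponential decay
  properties», at `m² = 0`: for `a > 0`, `0 ≤ δ ≤ 1` with `2(d+1)δ² + a(e^δ − 1) ≤ min(2,a)/2`, every mesh, every finite
  union `R` of blocks, `g` supported in `T ≠ ∅` and `S` with `η|x − t|_∞ ≥ ρ` on `S × T`:
  `Σ_{x∈S} (G_k(Ω,0)g)(x)² ≤ (2/min(2,a))²e^{−2δρ}Σ_x g(x)²`, and the kernel bound
  `|G(x,t)| ≤ (2/min(2,a))e^{−δη|x−t|_∞}` — Combes–Thomas in the quadratic-form version of the lineage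
  (`Beta.CombesThomasFormOp.setDecay_lattice_dist`) fed with the `η`-free coercivity of §6.
* A numerical instance (`d + 1 = 4`, `n = 8`, `a = 1`, `δ = 1/10`, any `Ω`) checks that the hypotheses are satisfiable.

Mechanism of §6 (for the referee): `fineOpR n a 0 R = lap c + Σ_b (a/|b|)·1_b ⊗ 1_b` entrywise (§5, `fineOpR_zero_eq`)
with the coupling `c(x,y) = n²·[y ~ x, both in R]` (§3) and the blocks of `R` (§4, charts `rchart` from
`B4Green244.finePt`); the block Poincaré inequality `Σ_{x∈b}(g(x) − avg_b g)² ≤ (n²/2)·(1/n²)Σ_{bonds in b}(g(b₊) − g(b₋))²`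
(§4, from `Beta.CoordCubePoincare.blockPoincare_of_charts`, constant `ℓ(ℓ+1)/2 ≤ (ℓ+1)²/2` for `n = ℓ + 1 ≥ 2`; trivial
for `n = 1`) and `Beta.BlockPoincare.coercive_lap_blocks` give coercivity `min(n²/(n²/2), a) = min(2, a)`.  Every bond
inside a block has both ends in `R` BECAUSE `R` is a union of blocks — this is exactly where the hypothesis
«Ω which are unions of (big) blocks» enters; for regions cutting blocks no `η`-uniform bound holds (a region one fine
layer thick: `g ≡ 1` has Rayleigh quotient `a/n`).

## DICTIONARY (folklore; each line is used only through the kernel-checked identities named)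

* paper's dimension `d` ↔ our `d + 1 =: D`; `η = L^{-k}` ↔ `1/n` (only `n ≥ 1` is used); `x ∈ Ω ⊂ ηℤ^D` ↔
  `x ∈ R ⊂ ℤ^D` (lattice units), `x ∈ B^k(y)` ↔ `blk n x = y` (1.1) (`B4Green242Bridge.blk`, `B4BoxCov237.blk_finePt`).
* `A = 0`: `U(A_b) = 1`, `U(A(Γ)) = 1`; the `N` components decouple, so the real scalar case (`N = 1`) typed here is
  each component of the printed `φ : Ω → R^N`.
* inner product `⟨φ,ψ⟩ = Σ_{x∈Ω} η^Dφ(x)ψ(x)` on `Ω`, counting inner product on the unit lattice (the convention under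
  which (1.3)–(1.5) are stated); then `(Q_k^*ψ)(x) = ψ(y_x)`, `⟨φ, aP_kφ⟩ = a‖Q_kφ‖² = aη^{2D}Σ_y(Σ_{x∈B(y)}φ(x))²`,
  `⟨φ,(−Δ^{η,N}_{0,Ω})φ⟩ = η^{D−2}Σ_{bonds ⊂ Ω}(φ(b₊) − φ(b₋))²` (1.3), and `X ≥ γ₀I` means `⟨φ,Xφ⟩ ≥ γ₀⟨φ,φ⟩`.
  Dividing by `η^D > 0`: `(1.8) at A = 0` ⇔ `min(2,a)(g ⬝ᵥ g) ≤ g ⬝ᵥ (fineOpR n a 0 R) g` for all `g` — `lower18_zero`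
  (and `fineOpR_form` is the kernel-checked form of `η^{-D}⟨φ,Xφ⟩` in lattice units).
* the operator `X = −Δ^{η,N}_{0,Ω} + m² + aP_k(0)` ACTS by `(Xφ)(x) = Σ_{x′∈Ω} (fineOpR)(x,x′)φ(x′)` (no `η`-factors:
  `η^{-2}`·graph Laplacian, `m²`, and `(aQ_k^*Q_kφ)(x) = aη^DΣ_{x′∈B(y_x)}φ(x′)`), so
  `(G_k(Ω,0)f)(x) = ((fineOpR)⁻¹.mulVec f)(x)`; if kernels are normalised by `(Gf)(x) = Σ_{x′} η^DG(x,x′)f(x′)` then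
  `G_k(Ω,0; x,x′) = η^{-D}·(fineOpR n a m² R)⁻¹(x,x′)`.
* `dist`, `|x − x′|` ↔ `η|x − x′|_∞` in lattice units (`edistR`, §8; sup-norm `B4ContourShift.supNorm`).

## HONEST SCOPE

* `A = 0` ONLY.  Nothing is certified about `A ≠ 0`, the charge `e`, regular fields (1.7), the covariant derivative
  bounds, (1.9), or the Hölder quotient; the printed (1.8) for small `e` and regular `A` remains the typed hypothesis
  `B4.Claim18Printed` of the skeleton module `B4` (abstract carrier) — this file is a concrete kernel certificate of
  its `A = 0` slice, with the explicit constant `γ₀ = min(2, a)` (`= a` for the paper's «a … close to 1»).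
* Regions: EVERY finite `R ⊂ ℤ^{d+1}` that is a union of `n`-blocks (= unit blocks `B^k(y)` of the print) — a class
  containing the print's «unions of big blocks» (big blocks are unions of unit blocks); FINITE regions only (the torus
  case, with the same constant, is `Beta.TorusG0Decay.coercive_torus` / `setDecay_torus`; infinite `Ω ⊂ ηℤ^d` are not
  typed).  Neumann boundary conditions exactly as printed (bonds with both end-points in `Ω`).
* The mass: (1.8) has no `m²`; `fineOpR` carries `m²·1` for any real `m²` and the bound is `min(2,a) + m²`
  (`fineOpR_eq_add_smul`); §8 (decay) is typed at `m² = 0` only.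
* §8 is an `L²` set-to-set / kernel statement with an explicit but non-optimal rate window; it is NOT the printed
  (1.10) (pointwise, `‖f‖_∞`, restriction `dist(x, Ω^c) ≥ R₀`), whose proof (Sect. 2–3 of the paper) needs the
  short-distance regularity this file does not touch (summing the kernel bound of §8 over `supp f` costs a factor
  `#supp f ~ η^{-(d+1)}` and gives nothing uniform in `η` pointwise).
* value = kernel certificate of the `A = 0` Neumann-region lower bound (1.8) with explicit constant, of the (1.3)–(1.6)
  dictionary, and of an `η`-, `Ω`-uniform `L²` Combes–Thomas decay of `G_k(Ω,0)`; NOT summit progress.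

[cite: Balaban1983RegularityDecay, p. 572 (1.1) (1.3)–(1.6), p. 573 (1.8) (1.10)] [cite: CombesThomas1973, §II]
-/

namespace Literature.MathematicalPhysics.QuantumFieldTheory.Balaban1983to89.B4Lower18

open Finset Matrix
open Literature.MathematicalPhysics.QuantumFieldTheory.Balaban1983to89.B4ContourShift (supNorm supNorm_nonneg)
open Literature.MathematicalPhysics.QuantumFieldTheory.Balaban1983to89.B4Reflection242
open Literature.MathematicalPhysics.QuantumFieldTheory.Balaban1983to89.B4Green242Bridge
open Literature.MathematicalPhysics.QuantumFieldTheory.Balaban1983to89.B4BoxCov237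
open B4Green244 (finePt)
open Beta.BlockPoincare (avg coercive_lap_blocks quadForm_rankOne_sum)
open Beta.CoordCubePoincare (stepUp blockPoincare_of_charts)
open Beta.CombesThomasForm (lap lap_form)
open Beta.CombesThomasFormOp (setDecay_lattice_dist)

noncomputable section

variable {d : ℕ}

/-! ## §1  Regions that are unions of blocks; the fine region over a set of unit labels -/

/-- `R ⊂ ℤ^{d+1}` (fine points, lattice units) is a UNION OF `n`-BLOCKS: it is closed under «same block label».
[folklore] -/
def IsBlockUnion (n : ℕ) (R : Finset (Fin (d + 1) → ℤ)) : Prop :=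
  ∀ ⦃x : Fin (d + 1) → ℤ⦄, x ∈ R → ∀ ⦃z : Fin (d + 1) → ℤ⦄, blk n z = blk n x → z ∈ R

/-- the fine region over a finite set `Ω` of unit labels: the union of the blocks `B(y)`, `y ∈ Ω`
(B4 (1.1): `B^k(y) = {x ∈ ηℤ^d : y_μ ≤ x_μ < y_μ + 1}`, in lattice units `{x : blk n x = y}`).
[cite: Balaban1983RegularityDecay, p. 572 (1.1), dictionary] [folklore] -/
def fineDom (n : ℕ) (Ω : Finset (Fin (d + 1) → ℤ)) : Finset (Fin (d + 1) → ℤ) :=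
  Ω.biUnion fun y => Finset.univ.image (finePt n y)

/-- a fine point lies in the fine region iff its block label lies in `Ω`. [folklore] -/
theorem mem_fineDom {n : ℕ} (hn : 1 ≤ n) {Ω : Finset (Fin (d + 1) → ℤ)} {x : Fin (d + 1) → ℤ} :
    x ∈ fineDom n Ω ↔ blk n x ∈ Ω := by
  simp only [fineDom, Finset.mem_biUnion, Finset.mem_image, Finset.mem_univ, true_and]
  constructor
  · rintro ⟨y, hy, j, rfl⟩
    rwa [blk_finePt hn]
  · intro h
    obtain ⟨j, hj⟩ := finePt_offset_of_blk hn (rfl : blk n x = blk n x)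
    exact ⟨blk n x, h, j, hj⟩

/-- the fine region over `Ω` is a union of blocks. [folklore] -/
theorem fineDom_isBlockUnion {n : ℕ} (hn : 1 ≤ n) (Ω : Finset (Fin (d + 1) → ℤ)) :
    IsBlockUnion n (fineDom n Ω) := by
  intro x hx z hz
  rw [mem_fineDom hn] at hx ⊢
  rwa [hz]

/-- the fine box `Π_μ[0, nM_μ)` is a union of blocks. [folklore] -/
theorem boxDom_isBlockUnion {n : ℕ} (hn : 1 ≤ n) (M : Fin (d + 1) → ℕ) :
    IsBlockUnion n (boxDom (fun i => n * M i)) := by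
  intro x hx z hz
  have hb : blk n z ∈ boxDom M := by rw [hz]; exact blk_mem_boxDom hn hx
  obtain ⟨j, hj⟩ := finePt_offset_of_blk hn (rfl : blk n z = blk n z)
  rw [← hj]
  exact finePt_mem_boxDom n hb j

/-- the fine region over the unit box `Π_μ[0, M_μ)` is the fine box `Π_μ[0, nM_μ)`. [folklore] -/
theorem fineDom_boxDom {n : ℕ} (hn : 1 ≤ n) (M : Fin (d + 1) → ℕ) :
    fineDom n (boxDom M) = boxDom (fun i => n * M i) := by
  ext x
  rw [mem_fineDom hn]
  constructor
  · intro h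
    obtain ⟨j, hj⟩ := finePt_offset_of_blk hn (rfl : blk n x = blk n x)
    rw [← hj]
    exact finePt_mem_boxDom n h j
  · exact blk_mem_boxDom hn

/-! ## §2  The operator `c₁(−Δ^N_R) + msq + a·1_{same block}` of a finite region `R` with Neumann boundary
conditions; dictionary with `B4BoxCov237.opBoxR` / `boxOpR` -/

/-- the NEUMANN LAPLACIAN KERNEL of a finite region `R ⊂ ℤ^{d+1}` (graph Laplacian of the induced nearest-neighbour
graph): the number of neighbours INSIDE `R` on the diagonal, `−1` on nearest-neighbour pairs
(`B4Reflection242.neumannLapK` is the case `R` = a box). [folklore] -/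
def neumannLapR (R : Finset (Fin (d + 1) → ℤ)) (x y : Fin (d + 1) → ℤ) : ℝ :=
  if y = x then ((((nbrs x).filter fun z => z ∈ R).card : ℕ) : ℝ) else if y ∈ nbrs x then -1 else 0

/-- on a box the region kernel is the lineage's box kernel. [folklore] -/
theorem neumannLapR_boxDom (N : Fin (d + 1) → ℕ) (x y : Fin (d + 1) → ℤ) :
    neumannLapR (boxDom N) x y = neumannLapK N x y := by
  unfold neumannLapR neumannLapK
  rfl

/-- the operator `c₁(−Δ^N_R) + msq + a·1_{blk · = blk ·}` of a finite region as a REAL matrix on `R`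
(`B4BoxCov237.opBoxR` is the case of a box, `regionOpR_boxDom`). [folklore] -/
def regionOpR (c₁ msq a : ℝ) (b : ℕ) (R : Finset (Fin (d + 1) → ℤ)) : Matrix ↥R ↥R ℝ :=
  Matrix.of fun x y => c₁ * neumannLapR R x.1 y.1 + (diagK msq x.1 y.1 + avgK a b x.1 y.1)

/-- on a box, `regionOpR` is `B4BoxCov237.opBoxR`. [folklore] -/
theorem regionOpR_boxDom (c₁ msq a : ℝ) (b : ℕ) (N : Fin (d + 1) → ℕ) :
    regionOpR c₁ msq a b (boxDom N) = opBoxR c₁ msq a b N := by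
  ext x y
  simp only [regionOpR, opBoxR, Matrix.of_apply, neumannLapR_boxDom]

/-- **THE OPERATOR OF B4 (1.6) AT `A = 0` IN LATTICE UNITS**: `n²(−Δ^N_R) + m2 + (a/n^{d+1})·1_{same n-block}` on a
finite region `R ⊂ ℤ^{d+1}` (`= η^{-1}Ω`, `η = 1/n`), the matrix of `−Δ^{η,N}_Ω + m² + aP_k(0)` acting on functions
of the fine points (dictionary in the module docstring).
[cite: Balaban1983RegularityDecay, p. 572 (1.3)–(1.6), dictionary] [folklore] -/
def fineOpR (n : ℕ) (a m2 : ℝ) (R : Finset (Fin (d + 1) → ℤ)) : Matrix ↥R ↥R ℝ :=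
  regionOpR ((n : ℝ) ^ 2) m2 (a * ((n : ℝ) ^ (d + 1))⁻¹) n R

/-- on the fine box `Π_μ[0, nM_μ)`, `fineOpR` is the lineage's `B4BoxCov237.boxOpR` (whose complex cast is
`B4Green242Bridge.boxOp`, the typing of (2.42)/(2.44)). [folklore] -/
theorem fineOpR_boxDom (n : ℕ) (a m2 : ℝ) (M : Fin (d + 1) → ℕ) :
    fineOpR n a m2 (boxDom (fun i => n * M i)) = boxOpR n a m2 M := by
  unfold fineOpR boxOpR
  rw [regionOpR_boxDom]

/-- the region kernel is symmetric. [folklore] -/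
theorem regionOpR_apply_comm (c₁ msq a : ℝ) (b : ℕ) (R : Finset (Fin (d + 1) → ℤ)) (x y : ↥R) :
    regionOpR c₁ msq a b R x y = regionOpR c₁ msq a b R y x := by
  simp only [regionOpR, Matrix.of_apply, neumannLapR, diagK, avgK]
  by_cases hxy : x = y
  · subst hxy; rfl
  · have h1 : x.1 ≠ y.1 := fun h => hxy (Subtype.ext h)
    have h2 : y.1 ≠ x.1 := fun h => hxy (Subtype.ext h.symm)
    have hn : (y.1 ∈ nbrs x.1) = (x.1 ∈ nbrs y.1) := propext nbrs_comm
    have hb : (blk b y.1 = blk b x.1) = (blk b x.1 = blk b y.1) := propext eq_comm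
    simp only [h1, h2, if_false, hn, hb]

/-- the region operator is a symmetric matrix. [folklore] -/
theorem regionOpR_isSymm (c₁ msq a : ℝ) (b : ℕ) (R : Finset (Fin (d + 1) → ℤ)) :
    (regionOpR c₁ msq a b R).IsSymm := by
  ext x y
  exact regionOpR_apply_comm c₁ msq a b R y x

/-- `fineOpR` is a symmetric matrix. [folklore] -/
theorem fineOpR_isSymm (n : ℕ) (a m2 : ℝ) (R : Finset (Fin (d + 1) → ℤ)) : (fineOpR n a m2 R).IsSymm :=
  regionOpR_isSymm _ _ _ _ _

/-- the mass term splits off: `fineOpR n a m2 = fineOpR n a 0 + m2·1`. [folklore] -/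
theorem fineOpR_eq_add_smul (n : ℕ) (a m2 : ℝ) (R : Finset (Fin (d + 1) → ℤ)) :
    fineOpR n a m2 R = fineOpR n a 0 R + m2 • (1 : Matrix ↥R ↥R ℝ) := by
  ext x y
  simp only [fineOpR, regionOpR, Matrix.of_apply, Matrix.add_apply, Matrix.smul_apply, Matrix.one_apply,
    diagK, smul_eq_mul, mul_ite, mul_one, mul_zero]
  by_cases h : x = y
  · subst h; simp; ring
  · have h1 : y.1 ≠ x.1 := fun h' => h (Subtype.ext h'.symm)
    simp [h, h1]

/-- the quadratic form with the mass term split off. [folklore] -/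
theorem fineOpR_form_eq (n : ℕ) (a m2 : ℝ) (R : Finset (Fin (d + 1) → ℤ)) (g : ↥R → ℝ) :
    g ⬝ᵥ (fineOpR n a m2 R).mulVec g = g ⬝ᵥ (fineOpR n a 0 R).mulVec g + m2 * (g ⬝ᵥ g) := by
  rw [fineOpR_eq_add_smul, Matrix.add_mulVec, dotProduct_add, Matrix.smul_mulVec, dotProduct_smul,
    smul_eq_mul, Matrix.one_mulVec]

/-! ## §3  The bonds of a region and the coupling function -/

/-- **THE ORIENTED BONDS OF A REGION AS A FINITE TYPE**: pairs `(x, μ)` with `x, x + e_μ ∈ R` — the bonds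
`b = ⟨b₋, b₊⟩` «with end-points b₋, b₊ in Ω» of (1.3), each unordered bond listed once. [folklore] -/
abbrev RBond (R : Finset (Fin (d + 1) → ℤ)) : Type :=
  {p : ↥R × Fin (d + 1) // p.1.1 + uvec p.2 ∈ R}

/-- source `x` of the bond `(x, μ)`. [folklore] -/
def rsrc {R : Finset (Fin (d + 1) → ℤ)} (k : RBond R) : ↥R := k.1.1

/-- target `x + e_μ` of the bond `(x, μ)`. [folklore] -/
def rtgt {R : Finset (Fin (d + 1) → ℤ)} (k : RBond R) : ↥R := ⟨k.1.1.1 + uvec k.1.2, k.2⟩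

/-- `e_μ + e_ν ≠ 0`. [folklore] -/
theorem uvec_add_uvec_ne_zero (μ ν : Fin (d + 1)) : uvec μ + uvec ν ≠ (0 : Fin (d + 1) → ℤ) := by
  intro h
  have h1 := congrFun h μ
  rw [Pi.add_apply, uvec_apply_same, Pi.zero_apply] at h1
  by_cases hμν : μ = ν
  · subst hμν
    rw [uvec_apply_same] at h1
    omega
  · rw [uvec_apply_ne hμν] at h1
    omega

/-- a bond is determined by its endpoints. [folklore] -/
theorem rbond_injective (R : Finset (Fin (d + 1) → ℤ)) :
    Function.Injective fun k : RBond R => (rsrc k, rtgt k) := by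
  intro k k' h
  simp only [Prod.mk.injEq, rsrc, rtgt, Subtype.mk.injEq] at h
  obtain ⟨h1, h2⟩ := h
  have h3 : uvec k.1.2 = uvec k'.1.2 := by
    have := congrArg Subtype.val h1
    rw [this] at h2
    exact add_left_cancel h2
  exact Subtype.ext (Prod.ext h1 (uvec_injective h3))

/-- no bond is listed in both orientations. [folklore] -/
theorem rbond_anti (R : Finset (Fin (d + 1) → ℤ)) (k k' : RBond R) : (rsrc k, rtgt k) ≠ (rtgt k', rsrc k') := by
  intro h
  simp only [Prod.mk.injEq, rsrc, rtgt] at h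
  obtain ⟨h1, h2⟩ := h
  have h1' := congrArg Subtype.val h1
  have h2' := congrArg Subtype.val h2
  simp only at h1' h2'
  apply uvec_add_uvec_ne_zero k'.1.2 k.1.2
  have : k'.1.1.1 + (uvec k'.1.2 + uvec k.1.2) = k'.1.1.1 + 0 := by
    rw [← add_assoc, ← h1', h2', add_zero]
  exact add_left_cancel this

/-- the COUPLING FUNCTION `c(x, y) = n²·[y ~ x]` of the region's nearest-neighbour graph. [folklore] -/
def adjC (n : ℕ) (R : Finset (Fin (d + 1) → ℤ)) (x y : ↥R) : ℝ := if y.1 ∈ nbrs x.1 then ((n : ℝ)) ^ 2 else 0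

/-- the coupling is symmetric. [folklore] -/
theorem adjC_symm (n : ℕ) (R : Finset (Fin (d + 1) → ℤ)) (x y : ↥R) : adjC n R x y = adjC n R y x := by
  unfold adjC
  by_cases h : y.1 ∈ nbrs x.1
  · rw [if_pos h, if_pos (nbrs_comm.1 h)]
  · rw [if_neg h, if_neg (fun h' => h (nbrs_comm.1 h'))]

/-- the coupling is non-negative. [folklore] -/
theorem adjC_nonneg (n : ℕ) (R : Finset (Fin (d + 1) → ℤ)) (x y : ↥R) : 0 ≤ adjC n R x y := by
  unfold adjC
  split_ifs <;> positivity

/-- on a bond the coupling is `n²`. [folklore] -/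
theorem adjC_bond (n : ℕ) {R : Finset (Fin (d + 1) → ℤ)} (k : RBond R) : adjC n R (rsrc k) (rtgt k) = (n : ℝ) ^ 2 := by
  have h : (rtgt k).1 ∈ nbrs (rsrc k).1 := mem_nbrs.2 ⟨k.1.2, Or.inl rfl⟩
  simp only [adjC, h, if_true]

/-! ## §4  Block labels, block charts, and the block Poincaré inequality of a region -/

/-- the block label of a point of the region, as an element of the finite set of labels present. [folklore] -/
def rblk (n : ℕ) (R : Finset (Fin (d + 1) → ℤ)) (x : ↥R) : ↥(R.image (blk n)) :=
  ⟨blk n x.1, Finset.mem_image_of_mem _ x.2⟩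

/-- the chart of a block of a block-union region: offset `j ↦ n·b + j`. [folklore] -/
def rchart {n : ℕ} (hn : 1 ≤ n) {R : Finset (Fin (d + 1) → ℤ)} (hR : IsBlockUnion n R)
    (b : ↥(R.image (blk n))) (j : Fin (d + 1) → Fin n) : ↥R :=
  ⟨finePt n b.1 j, by
    obtain ⟨x, hx, hxb⟩ := Finset.mem_image.1 b.2
    exact hR hx ((blk_finePt hn b.1 j).trans hxb.symm)⟩

/-- the block label of a chart point is the block it was charted from. [folklore] -/
theorem rblk_rchart {n : ℕ} (hn : 1 ≤ n) {R : Finset (Fin (d + 1) → ℤ)} (hR : IsBlockUnion n R)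
    (b : ↥(R.image (blk n))) (j : Fin (d + 1) → Fin n) : rblk n R (rchart hn hR b j) = b :=
  Subtype.ext (blk_finePt hn b.1 j)

/-- the block chart is injective. [folklore] -/
theorem rchart_injective {n : ℕ} (hn : 1 ≤ n) {R : Finset (Fin (d + 1) → ℤ)} (hR : IsBlockUnion n R)
    (b : ↥(R.image (blk n))) : Function.Injective (rchart hn hR b) := fun _ _ h =>
  finePt_injective n b.1 (congrArg Subtype.val h)

/-- every point of the region is a chart point of its own block. [folklore] -/
theorem rchart_surj {n : ℕ} (hn : 1 ≤ n) {R : Finset (Fin (d + 1) → ℤ)} (hR : IsBlockUnion n R) (x : ↥R) :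
    ∃ j, rchart hn hR (rblk n R x) j = x := by
  obtain ⟨j, hj⟩ := finePt_offset_of_blk (n := n) hn (rfl : blk n x.1 = (rblk n R x).1)
  exact ⟨j, Subtype.ext hj⟩

/-- a block of the region is the image of its chart. [folklore] -/
theorem filter_rblk_eq_image {n : ℕ} (hn : 1 ≤ n) {R : Finset (Fin (d + 1) → ℤ)} (hR : IsBlockUnion n R)
    (b : ↥(R.image (blk n))) :
    Finset.univ.filter (fun x : ↥R => rblk n R x = b) = Finset.univ.image (rchart hn hR b) := by
  ext x
  simp only [Finset.mem_filter, Finset.mem_univ, true_and, Finset.mem_image]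
  constructor
  · rintro rfl
    exact rchart_surj hn hR x
  · rintro ⟨j, rfl⟩
    exact rblk_rchart hn hR b j

/-- every block of the region has exactly `n^{d+1}` points. [folklore] -/
theorem card_filter_rblk {n : ℕ} (hn : 1 ≤ n) {R : Finset (Fin (d + 1) → ℤ)} (hR : IsBlockUnion n R)
    (b : ↥(R.image (blk n))) : (Finset.univ.filter (fun x : ↥R => rblk n R x = b)).card = n ^ (d + 1) := by
  rw [filter_rblk_eq_image hn hR b, Finset.card_image_of_injective _ (rchart_injective hn hR b), Finset.card_univ,
    Fintype.card_fun, Fintype.card_fin, Fintype.card_fin]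

/-- a coordinate step from a non-last chart offset stays in the region (block size `ℓ + 1`). [folklore] -/
theorem rchart_step_mem {ℓ : ℕ} {R : Finset (Fin (d + 1) → ℤ)} (hR : IsBlockUnion (ℓ + 1) R)
    (b : ↥(R.image (blk (ℓ + 1)))) {j : Fin (d + 1) → Fin (ℓ + 1)} {μ : Fin (d + 1)} (h : j μ ≠ Fin.last ℓ) :
    (rchart (by omega) hR b j).1 + uvec μ ∈ R := by
  show finePt (ℓ + 1) b.1 j + uvec μ ∈ R
  rw [← finePt_stepUp ℓ b.1 j μ h]
  exact (rchart (by omega) hR b (stepUp j μ)).2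

/-- the bond listing of a block (block size `ℓ + 1 ≥ 2`): the internal step `⟨(ℓ+1)b + j, (ℓ+1)b + j + e_μ⟩` for
`j μ ≠ last`, a fixed internal bond otherwise. [folklore] -/
def rbond {ℓ : ℕ} (hℓ : 1 ≤ ℓ) {R : Finset (Fin (d + 1) → ℤ)} (hR : IsBlockUnion (ℓ + 1) R)
    (b : ↥(R.image (blk (ℓ + 1)))) (μ : Fin (d + 1)) (j : Fin (d + 1) → Fin (ℓ + 1)) : RBond R :=
  if h : j μ ≠ Fin.last ℓ then ⟨(rchart (by omega) hR b j, μ), rchart_step_mem hR b h⟩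
  else ⟨(rchart (by omega) hR b (Function.update j μ 0), μ),
    rchart_step_mem hR b (j := Function.update j μ 0) (by rw [Function.update_self]; exact zero_ne_last hℓ)⟩

/-- the bond attached to a non-last offset is the genuine bond. [folklore] -/
theorem rbond_pos {ℓ : ℕ} (hℓ : 1 ≤ ℓ) {R : Finset (Fin (d + 1) → ℤ)} (hR : IsBlockUnion (ℓ + 1) R)
    (b : ↥(R.image (blk (ℓ + 1)))) {μ : Fin (d + 1)} {j : Fin (d + 1) → Fin (ℓ + 1)} (h : j μ ≠ Fin.last ℓ) :
    rbond hℓ hR b μ j = ⟨(rchart (by omega) hR b j, μ), rchart_step_mem hR b h⟩ := dif_pos h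

/-- **POINCARÉ ON EVERY BLOCK OF THE REGION** (block size `ℓ + 1 ≥ 2`) with constant `ℓ(ℓ+1)/2`, relative to the
bonds inside the block (`Beta.CoordCubePoincare.blockPoincare_of_charts`). [folklore] -/
theorem rblock_poincare {ℓ : ℕ} (hℓ : 1 ≤ ℓ) {R : Finset (Fin (d + 1) → ℤ)} (hR : IsBlockUnion (ℓ + 1) R)
    (b : ↥(R.image (blk (ℓ + 1)))) (f : ↥R → ℝ) :
    ∑ i ∈ Finset.univ.filter (fun i => rblk (ℓ + 1) R i = b),
        (f i - avg (Finset.univ.filter fun i => rblk (ℓ + 1) R i = b) f) ^ 2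
      ≤ (ℓ : ℝ) * (ℓ + 1) / 2 *
        ∑ k ∈ Finset.univ.filter (fun k : RBond R => rblk (ℓ + 1) R (rsrc k) = b ∧ rblk (ℓ + 1) R (rtgt k) = b),
          (f (rtgt k) - f (rsrc k)) ^ 2 := by
  refine blockPoincare_of_charts (rblk (ℓ + 1) R) rsrc rtgt ℓ (d + 1) (rchart (by omega) hR)
    (rblk_rchart (by omega) hR) (rchart_injective (by omega) hR) (rchart_surj (by omega) hR) (rbond hℓ hR)
    ?_ ?_ ?_ b f
  · intro b μ j h
    rw [rbond_pos hℓ hR b h]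
    rfl
  · intro b μ j h
    rw [rbond_pos hℓ hR b h]
    apply Subtype.ext
    show (rchart (by omega) hR b j).1 + uvec μ = (rchart (by omega) hR b (stepUp j μ)).1
    exact (finePt_stepUp ℓ b.1 j μ h).symm
  · intro b p hp q hq hpq
    simp only [Set.mem_setOf_eq] at hp hq
    have h1 : rbond hℓ hR b p.1 p.2 = rbond hℓ hR b q.1 q.2 := hpq
    rw [rbond_pos hℓ hR b hp, rbond_pos hℓ hR b hq] at h1
    have h2 := congrArg Subtype.val h1
    simp only [Prod.mk.injEq] at h2
    exact Prod.ext h2.2 (rchart_injective (by omega) hR b h2.1)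

/-- for block size `1` every block of the region is a single point, so its variance vanishes. [folklore] -/
theorem rblock_var_eq_zero_one {R : Finset (Fin (d + 1) → ℤ)} (hR : IsBlockUnion 1 R) (b : ↥(R.image (blk 1)))
    (f : ↥R → ℝ) :
    ∑ i ∈ Finset.univ.filter (fun i => rblk 1 R i = b),
        (f i - avg (Finset.univ.filter fun i => rblk 1 R i = b) f) ^ 2 = 0 := by
  have himg : Finset.univ.filter (fun i => rblk 1 R i = b) = {rchart le_rfl hR b default} := by
    rw [filter_rblk_eq_image le_rfl hR b, Finset.univ_unique, Finset.image_singleton]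
  rw [himg, Finset.sum_singleton]
  simp [avg]

/-! ## §5  The entrywise identity `fineOpR n a 0 R = lap c + Σ_b (a/|b|)·1_b ⊗ 1_b` -/

/-- a sum of products of two block indicators. [folklore] -/
theorem sum_ind_mul_ind {β : Type*} [Fintype β] [DecidableEq β] (c : β → ℝ) (u v : β) :
    ∑ b, c b * ((if u = b then (1 : ℝ) else 0) * (if v = b then (1 : ℝ) else 0)) = if v = u then c u else 0 := by
  rw [Finset.sum_eq_single u]
  · by_cases h : v = u
    · simp [h]
    · simp [h]
  · intro b _ hb
    have : u ≠ b := fun h => hb h.symm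
    simp [this]
  · intro h; exact absurd (Finset.mem_univ u) h

/-- the in-region degree, counted on the region side. [folklore] -/
theorem sum_adjC_eq (n : ℕ) (R : Finset (Fin (d + 1) → ℤ)) (x : ↥R) :
    ∑ l : ↥R, adjC n R x l = (n : ℝ) ^ 2 * ((((nbrs x.1).filter fun z => z ∈ R).card : ℕ) : ℝ) := by
  unfold adjC
  rw [← Finset.sum_filter, Finset.sum_const, nsmul_eq_mul, mul_comm]
  congr 2
  rw [← Finset.card_subtype (fun z => z ∈ R) (nbrs x.1)]
  congr 1
  ext l
  simp [Finset.mem_subtype]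

/-- **THE ENTRYWISE IDENTITY**: on a union of `n`-blocks, `n²(−Δ^N_R) + (a/n^{d+1})·1_{same block}` is the weighted
graph Laplacian of the coupling `n²·[y ~ x]` plus `Σ_b (a/|b|)·1_b ⊗ 1_b` — the shape of
`Beta.BlockPoincare.coercive_lap_blocks`. [folklore] -/
theorem fineOpR_zero_eq {n : ℕ} (hn : 1 ≤ n) {R : Finset (Fin (d + 1) → ℤ)} (hR : IsBlockUnion n R) (a : ℝ)
    (x y : ↥R) :
    fineOpR n a 0 R x y = lap (adjC n R) x y
      + ∑ b, a / ((Finset.univ.filter fun i => rblk n R i = b).card : ℝ)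
          * ((if rblk n R x = b then (1 : ℝ) else 0) * (if rblk n R y = b then (1 : ℝ) else 0)) := by
  have hcard : ∀ b : ↥(R.image (blk n)), ((Finset.univ.filter fun i => rblk n R i = b).card : ℝ) = (n : ℝ) ^ (d + 1) := by
    intro b
    rw [card_filter_rblk hn hR b]
    push_cast
    rfl
  simp only [hcard]
  rw [sum_ind_mul_ind, Beta.CombesThomasForm.lap_apply, sum_adjC_eq]
  have hblk : (rblk n R y = rblk n R x) ↔ (blk n y.1 = blk n x.1) := by
    simp only [rblk, Subtype.mk.injEq]
  simp only [fineOpR, regionOpR, Matrix.of_apply, neumannLapR, diagK, avgK, adjC]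
  by_cases hxy : x = y
  · subst hxy
    have hnn : x.1 ∉ nbrs x.1 := not_mem_nbrs_self x.1
    simp only [if_true, hnn, if_false, sub_zero, div_eq_mul_inv]
    ring
  · have h1 : y.1 ≠ x.1 := fun h => hxy (Subtype.ext h.symm)
    rw [if_neg h1, if_neg h1, if_neg hxy, zero_sub]
    simp only [hblk]
    by_cases hadj : y.1 ∈ nbrs x.1
    · simp only [hadj, if_true, div_eq_mul_inv]
      split_ifs <;> ring
    · simp only [hadj, if_false, div_eq_mul_inv]
      split_ifs <;> ring

/-! ## §6  THE LOWER BOUND (1.8) AT `A = 0`, UNIFORMLY IN THE MESH AND IN THE REGION -/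

/-- **B4 (1.8) at `A = 0`, massless operator**: for EVERY mesh `η = 1/n` (`n ≥ 1`), EVERY finite union `R` of
`n`-blocks (`= η^{-1}Ω`, `Ω` any finite union of unit blocks) and every `a ≥ 0`,
`⟨g, (n²(−Δ^N_R) + (a/n^{d+1})·1_{same block})g⟩ ≥ min(2, a)·‖g‖²` — the printed
«−Δ^{η,N}_{A,Ω} + aP_k(A) ≥ γ₀I … γ₀ independent of the lattice spacing η, as well as of Ω» with the EXPLICIT
`γ₀ = min(2, a)` (and of `d`).  Mechanism: Poincaré on each block with constant `(n−1)n/2 ≤ n²/2` against the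
coupling `n²`, and the block term exactly `a·Σ_b |b|(avg_b g)²` (`Beta.BlockPoincare.coercive_lap_blocks`).
[cite: Balaban1983RegularityDecay, p. 573 (1.8), case A = 0] -/
theorem lower18_zero {n : ℕ} (hn : 1 ≤ n) {a : ℝ} (ha : 0 ≤ a) {R : Finset (Fin (d + 1) → ℤ)}
    (hR : IsBlockUnion n R) (g : ↥R → ℝ) :
    min 2 a * (g ⬝ᵥ g) ≤ g ⬝ᵥ (fineOpR n a 0 R).mulVec g := by
  classical
  have hn0 : (0 : ℝ) < n := by exact_mod_cast hn
  have hPoin : ∀ (b : ↥(R.image (blk n))) (f : ↥R → ℝ),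
      ∑ i ∈ Finset.univ.filter (fun i => rblk n R i = b),
          (f i - avg (Finset.univ.filter fun i => rblk n R i = b) f) ^ 2
        ≤ (n : ℝ) ^ 2 / 2 *
          ∑ k ∈ Finset.univ.filter (fun k : RBond R => rblk n R (rsrc k) = b ∧ rblk n R (rtgt k) = b),
            (f (rtgt k) - f (rsrc k)) ^ 2 := by
    obtain ⟨ℓ, rfl⟩ : ∃ ℓ, n = ℓ + 1 := ⟨n - 1, by omega⟩
    intro b f
    have hnonneg : 0 ≤ ∑ k ∈ Finset.univ.filter
        (fun k : RBond R => rblk (ℓ + 1) R (rsrc k) = b ∧ rblk (ℓ + 1) R (rtgt k) = b),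
          (f (rtgt k) - f (rsrc k)) ^ 2 := Finset.sum_nonneg fun _ _ => sq_nonneg _
    rcases Nat.eq_zero_or_pos ℓ with rfl | hℓ
    · rw [rblock_var_eq_zero_one hR b f]
      positivity
    · refine (rblock_poincare hℓ hR b f).trans (mul_le_mul_of_nonneg_right ?_ hnonneg)
      push_cast
      have hl : (0 : ℝ) ≤ ℓ := Nat.cast_nonneg ℓ
      nlinarith [hl]
  have h := coercive_lap_blocks (adjC n R) (adjC_symm n R) (adjC_nonneg n R) (rblk n R) rsrc rtgt
    ((n : ℝ) ^ 2) a ((n : ℝ) ^ 2 / 2) (by positivity) ha (by positivity) (fun k => (adjC_bond n k).ge)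
    (rbond_injective R) (rbond_anti R) hPoin (fineOpR n a 0 R) (fineOpR_zero_eq hn hR a) g
  have hγP : (n : ℝ) ^ 2 / ((n : ℝ) ^ 2 / 2) = 2 := by
    field_simp
  rwa [hγP] at h

/-- **B4 (1.8) at `A = 0` with the mass term of (1.6)**: `⟨g, (−Δ^{η,N}_Ω + m² + aP_k(0))g⟩ ≥ (min(2, a) + m²)‖g‖²`
for every mesh, every finite union of blocks, every `a ≥ 0` and every real `m²`.
[cite: Balaban1983RegularityDecay, p. 573 (1.8) with p. 572 (1.6), case A = 0] -/
theorem lower18 {n : ℕ} (hn : 1 ≤ n) {a : ℝ} (ha : 0 ≤ a) (m2 : ℝ) {R : Finset (Fin (d + 1) → ℤ)}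
    (hR : IsBlockUnion n R) (g : ↥R → ℝ) :
    (min 2 a + m2) * (g ⬝ᵥ g) ≤ g ⬝ᵥ (fineOpR n a m2 R).mulVec g := by
  rw [fineOpR_form_eq, add_mul]
  exact add_le_add (lower18_zero hn ha hR g) le_rfl

/-- (1.8) at `A = 0` as a `QGQInverse.Coercive` statement. [folklore] -/
theorem fineOpR_coercive {n : ℕ} (hn : 1 ≤ n) {a : ℝ} (ha : 0 ≤ a) (m2 : ℝ) {R : Finset (Fin (d + 1) → ℤ)}
    (hR : IsBlockUnion n R) : QGQInverse.Coercive (fineOpR n a m2 R) (min 2 a + m2) := fun g =>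
  lower18 hn ha m2 hR g

/-- «This bound justifies the definition (1.6)»: for `min(2, a) + m² > 0` (e.g. `a > 0`, `m² ≥ 0`) the operator of
(1.6) at `A = 0` is invertible on every finite union of blocks, so `(fineOpR …)⁻¹ = G_k(Ω, 0)` is a genuine inverse.
[cite: Balaban1983RegularityDecay, p. 573 (1.8) and p. 572 (1.6), case A = 0] -/
theorem fineOpR_isUnit {n : ℕ} (hn : 1 ≤ n) {a m2 : ℝ} (ha : 0 ≤ a) (hpos : 0 < min 2 a + m2)
    {R : Finset (Fin (d + 1) → ℤ)} (hR : IsBlockUnion n R) : IsUnit (fineOpR n a m2 R) :=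
  QGQInverse.isUnit_of_coercive hpos (fineOpR_coercive hn ha m2 hR)

/-- `G_k(Ω, 0)` is a genuine inverse: `(−Δ^{η,N}_Ω + m² + aP_k)·G_k(Ω, 0) = 1`. [folklore] -/
theorem fineOpR_mul_inv {n : ℕ} (hn : 1 ≤ n) {a m2 : ℝ} (ha : 0 ≤ a) (hpos : 0 < min 2 a + m2)
    {R : Finset (Fin (d + 1) → ℤ)} (hR : IsBlockUnion n R) :
    fineOpR n a m2 R * (fineOpR n a m2 R)⁻¹ = 1 :=
  Matrix.mul_nonsing_inv _ ((Matrix.isUnit_iff_isUnit_det _).1 (fineOpR_isUnit hn ha hpos hR))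

/-- `G_k(Ω, 0)·(−Δ^{η,N}_Ω + m² + aP_k) = 1`. [folklore] -/
theorem fineOpR_inv_mul {n : ℕ} (hn : 1 ≤ n) {a m2 : ℝ} (ha : 0 ≤ a) (hpos : 0 < min 2 a + m2)
    {R : Finset (Fin (d + 1) → ℤ)} (hR : IsBlockUnion n R) :
    (fineOpR n a m2 R)⁻¹ * fineOpR n a m2 R = 1 :=
  Matrix.nonsing_inv_mul _ ((Matrix.isUnit_iff_isUnit_det _).1 (fineOpR_isUnit hn ha hpos hR))

/-- **(1.8) at `A = 0` in the printed quantifier order** — «there exists a positive constant γ₀ such that …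
−Δ^{η,N}_{A,Ω} + aP_k(A) ≥ γ₀I … The constant γ₀ is independent of the lattice spacing η, as well as of Ω»: for
every `a > 0` ONE `γ₀ = min(2, a) > 0` serves every dimension, every mesh `η = 1/n` and every finite union `Ω` of
unit blocks (fine region `fineDom n Ω`). [cite: Balaban1983RegularityDecay, p. 573 (1.8), case A = 0] -/
theorem ineq18_A0 (a : ℝ) (ha : 0 < a) :
    ∃ γ₀ : ℝ, 0 < γ₀ ∧ γ₀ = min 2 a ∧
      ∀ (d n : ℕ), 1 ≤ n → ∀ (Ω : Finset (Fin (d + 1) → ℤ)) (g : ↥(fineDom n Ω) → ℝ),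
        γ₀ * (g ⬝ᵥ g) ≤ g ⬝ᵥ (fineOpR n a 0 (fineDom n Ω)).mulVec g :=
  ⟨min 2 a, lt_min (by norm_num) ha, rfl, fun _ _ hn Ω g => lower18_zero hn ha.le (fineDom_isBlockUnion hn Ω) g⟩

/-- **COROLLARY FOR THE LINEAGE'S BOX OPERATOR**: `⟨g, boxOpR n a m2 M g⟩ ≥ (min(2, a) + m2)‖g‖²` for every
`n ≥ 1`, every box `Π_μ[0, nM_μ)`, `a ≥ 0` — the uniform coercivity of the operator inverted in
`B4Green242Bridge.boxOp⁻¹ = G_j(□)` (so far the lineage had only its invertibility, `boxOpR_isUnit`). [folklore] -/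
theorem boxOpR_form_ge {n : ℕ} (hn : 1 ≤ n) {a : ℝ} (ha : 0 ≤ a) (m2 : ℝ) (M : Fin (d + 1) → ℕ)
    (g : ↥(boxDom (fun i => n * M i)) → ℝ) :
    (min 2 a + m2) * (g ⬝ᵥ g) ≤ g ⬝ᵥ (boxOpR n a m2 M).mulVec g := by
  rw [← fineOpR_boxDom]
  exact lower18 hn ha m2 (boxDom_isBlockUnion hn M) g

/-- Sanity instance: `d + 1 = 4`, mesh `η = 1/8`, `a = 1`, `m² = 0`, any finite set `Ω` of unit labels:
`‖g‖² ≤ ⟨g, (−Δ^{η,N}_Ω + P_k)g⟩` (`min(2, 1) = 1`). -/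
example (Ω : Finset (Fin 4 → ℤ)) (g : ↥(fineDom 8 Ω) → ℝ) :
    g ⬝ᵥ g ≤ g ⬝ᵥ (fineOpR (d := 3) 8 1 0 (fineDom 8 Ω)).mulVec g := by
  have h := lower18_zero (d := 3) (n := 8) (by norm_num) (a := 1) (by norm_num) (fineDom_isBlockUnion (by norm_num) Ω) g
  norm_num at h
  exact h

/-! ## §7  The quadratic form: (1.3) + `m²` + `a`·(1.5) in lattice units (certifies the dictionary) -/

/-- the massless operator as «weighted graph Laplacian + block term», as matrices. [folklore] -/
theorem fineOpR_zero_eq_add {n : ℕ} (hn : 1 ≤ n) {R : Finset (Fin (d + 1) → ℤ)} (hR : IsBlockUnion n R) (a : ℝ) :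
    fineOpR n a 0 R = lap (adjC n R)
      + Matrix.of (fun x y : ↥R => ∑ b, a / ((Finset.univ.filter fun i => rblk n R i = b).card : ℝ)
          * ((if rblk n R x = b then (1 : ℝ) else 0) * (if rblk n R y = b then (1 : ℝ) else 0))) :=
  Matrix.ext fun x y => by rw [Matrix.add_apply, Matrix.of_apply]; exact fineOpR_zero_eq hn hR a x y

/-- **THE QUADRATIC FORM OF THE OPERATOR OF (1.6) AT `A = 0` IN LATTICE UNITS** (`η = 1/n`, `R = η^{-1}Ω` a union of
blocks): `⟨g, (n²(−Δ^N_R) + m2 + (a/n^{d+1})1_{same block})g⟩ = (n²/2)·Σ_{x,y ∈ R, y ~ x}(g(x) − g(y))² + m2‖g‖²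
+ (a/n^{d+1})·Σ_b (Σ_{x ∈ b} g(x))²` — i.e. `η^{-(d+1)}`·[«Σ_{b⊂Ω} η^d|η^{−1}(φ(b₊) − φ(b₋))|²» (1.3) (each bond
«with end-points b₋, b₊ in Ω» once = half the sum over ordered nearest-neighbour pairs) + `m²‖φ‖²` +
`a‖Q_k(0)φ‖²` ((1.4)–(1.5), `(Q_kφ)(y) = Σ_{x∈B^k(y)} η^dφ(x)`)]: the matrix `fineOpR` IS the operator defined by the
printed quadratic form, written in the counting basis of the fine points.
[cite: Balaban1983RegularityDecay, p. 572 (1.3)–(1.6), dictionary] [folklore] -/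
theorem fineOpR_form {n : ℕ} (hn : 1 ≤ n) {R : Finset (Fin (d + 1) → ℤ)} (hR : IsBlockUnion n R) (a m2 : ℝ)
    (g : ↥R → ℝ) :
    g ⬝ᵥ (fineOpR n a m2 R).mulVec g
      = (n : ℝ) ^ 2 / 2 * (∑ x : ↥R, ∑ y : ↥R, if y.1 ∈ nbrs x.1 then (g x - g y) ^ 2 else 0)
        + a * ((n : ℝ) ^ (d + 1))⁻¹
            * ∑ b : ↥(R.image (blk n)), (∑ x ∈ Finset.univ.filter (fun x => rblk n R x = b), g x) ^ 2
        + m2 * (g ⬝ᵥ g) := by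
  have hcard : ∀ b : ↥(R.image (blk n)), ((Finset.univ.filter fun i => rblk n R i = b).card : ℝ) = (n : ℝ) ^ (d + 1) := by
    intro b
    rw [card_filter_rblk hn hR b]
    push_cast
    rfl
  have hlap : (∑ x : ↥R, ∑ y : ↥R, adjC n R x y * (g x - g y) ^ 2) / 2
      = (n : ℝ) ^ 2 / 2 * (∑ x : ↥R, ∑ y : ↥R, if y.1 ∈ nbrs x.1 then (g x - g y) ^ 2 else 0) := by
    have h1 : ∑ x : ↥R, ∑ y : ↥R, adjC n R x y * (g x - g y) ^ 2
        = (n : ℝ) ^ 2 * ∑ x : ↥R, ∑ y : ↥R, if y.1 ∈ nbrs x.1 then (g x - g y) ^ 2 else 0 := by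
      rw [Finset.mul_sum]
      refine Finset.sum_congr rfl fun x _ => ?_
      rw [Finset.mul_sum]
      refine Finset.sum_congr rfl fun y _ => ?_
      unfold adjC
      split_ifs <;> ring
    rw [h1]
    ring
  have hblock : g ⬝ᵥ (Matrix.of (fun x y : ↥R => ∑ b, a / ((Finset.univ.filter fun i => rblk n R i = b).card : ℝ)
        * ((if rblk n R x = b then (1 : ℝ) else 0) * (if rblk n R y = b then (1 : ℝ) else 0)))).mulVec g
      = a * ((n : ℝ) ^ (d + 1))⁻¹
          * ∑ b : ↥(R.image (blk n)), (∑ x ∈ Finset.univ.filter (fun x => rblk n R x = b), g x) ^ 2 := by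
    have h1 : g ⬝ᵥ (Matrix.of (fun x y : ↥R => ∑ b, a / ((Finset.univ.filter fun i => rblk n R i = b).card : ℝ)
          * ((if rblk n R x = b then (1 : ℝ) else 0) * (if rblk n R y = b then (1 : ℝ) else 0)))).mulVec g
        = ∑ x : ↥R, g x * ∑ y : ↥R, (∑ b, a / ((Finset.univ.filter fun i => rblk n R i = b).card : ℝ)
            * ((if rblk n R x = b then (1 : ℝ) else 0) * (if rblk n R y = b then (1 : ℝ) else 0))) * g y := by
      simp only [dotProduct, Matrix.mulVec, Matrix.of_apply]
    rw [h1, quadForm_rankOne_sum]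
    simp only [hcard, boole_mul, ← Finset.sum_filter]
    rw [← Finset.mul_sum, div_eq_mul_inv]
  rw [fineOpR_form_eq, fineOpR_zero_eq_add hn hR a, Matrix.add_mulVec, dotProduct_add,
    lap_form _ (adjC_symm n R), hlap, hblock]

/-- the massless form is the Dirichlet part plus the block part; in particular it is `≥ 0` termwise and the
Dirichlet part alone is `⟨g, n²(−Δ^N_R)g⟩`. [folklore] -/
theorem fineOpR_zero_form_nonneg {n : ℕ} (hn : 1 ≤ n) {R : Finset (Fin (d + 1) → ℤ)} (hR : IsBlockUnion n R)
    {a : ℝ} (ha : 0 ≤ a) (g : ↥R → ℝ) : 0 ≤ g ⬝ᵥ (fineOpR n a 0 R).mulVec g := by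
  rw [fineOpR_form hn hR a 0 g, zero_mul, add_zero]
  have h1 : 0 ≤ ∑ x : ↥R, ∑ y : ↥R, (if y.1 ∈ nbrs x.1 then (g x - g y) ^ 2 else (0 : ℝ)) :=
    Finset.sum_nonneg fun x _ => Finset.sum_nonneg fun y _ => by split_ifs <;> positivity
  positivity

/-! ## §8  The `η`-uniform set-to-set decay of `G_k(Ω, 0) = (−Δ^{η,N}_Ω + aP_k)⁻¹` (Combes–Thomas, `L²` form) -/

/-- the `η`-scaled sup-distance of fine points, `η|x − y|_∞` (`η = 1/n`). [folklore] -/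
def edistR (n : ℕ) (R : Finset (Fin (d + 1) → ℤ)) (x y : ↥R) : ℝ := (1 / (n : ℝ)) * supNorm (x.1 - y.1)

/-- nearest neighbours are at sup-distance `≤ 1`. [folklore] -/
theorem supNorm_sub_le_one_of_mem_nbrs {x z : Fin (d + 1) → ℤ} (hz : z ∈ nbrs x) : supNorm (x - z) ≤ 1 := by
  apply supNorm_le_of_forall
  intro i
  obtain ⟨j, rfl | rfl⟩ := mem_nbrs.1 hz
  · by_cases hij : i = j
    · subst hij; simp
    · simp [hij]
  · by_cases hij : i = j
    · subst hij; simp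
    · simp [hij]

/-- the number of in-region neighbours is at most `2(d+1)`. [folklore] -/
theorem card_filter_adjC_ne_zero_le (n : ℕ) (R : Finset (Fin (d + 1) → ℤ)) (x : ↥R) :
    ((Finset.univ.filter fun y : ↥R => adjC n R x y ≠ 0).card : ℝ) ≤ 2 * ((d : ℝ) + 1) := by
  have h1 : (Finset.univ.filter fun y : ↥R => adjC n R x y ≠ 0) ⊆ Finset.univ.filter fun y : ↥R => y.1 ∈ nbrs x.1 := by
    intro y hy
    simp only [Finset.mem_filter, Finset.mem_univ, true_and, adjC] at hy ⊢
    by_contra h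
    exact hy (if_neg h)
  have h2 : (Finset.univ.filter fun y : ↥R => y.1 ∈ nbrs x.1).card = ((nbrs x.1).filter fun z => z ∈ R).card := by
    rw [← Finset.card_subtype (fun z => z ∈ R) (nbrs x.1)]
    congr 1
    ext l
    simp [Finset.mem_subtype]
  have h3 : ((nbrs x.1).filter fun z => z ∈ R).card ≤ 2 * (d + 1) :=
    (Finset.card_filter_le _ _).trans (card_nbrs x.1).le
  have h4 : (Finset.univ.filter fun y : ↥R => adjC n R x y ≠ 0).card ≤ 2 * (d + 1) :=
    (Finset.card_le_card h1).trans (h2 ▸ h3)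
  exact_mod_cast h4

/-- **SET-TO-SET DECAY OF `G_k(Ω, 0)` UNIFORMLY IN THE MESH AND THE REGION** (Combes–Thomas in `L²` form, with the
`η`-free coercivity `min(2, a)` of §6): for `a > 0`, EVERY mesh `η = 1/n`, EVERY finite union `R = η^{-1}Ω` of
blocks, `0 ≤ δ ≤ 1` with `2(d+1)δ² + a(e^δ − 1) ≤ min(2, a)/2`, a source `g` supported in a nonempty `T`, a set `S`
with `η|x − t|_∞ ≥ ρ` for `x ∈ S`, `t ∈ T`, and any solution of `(n²(−Δ^N_R) + (a/n^{d+1})1_{same block})v = g`: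
`Σ_{x∈S} v(x)² ≤ (2/min(2,a))²·e^{−2δρ}·Σ_x g(x)²`.  (An `L²` set-to-set bound of the exponential type of the
paper's (1.10) at `A = 0`; it is NOT the printed pointwise `‖·‖_∞` statement (1.10).)
[cite: CombesThomas1973, §II] [folklore] -/
theorem setDecay_region {n : ℕ} (hn : 1 ≤ n) {R : Finset (Fin (d + 1) → ℤ)} (hR : IsBlockUnion n R) {a δ : ℝ}
    (ha : 0 < a) (hδ0 : 0 ≤ δ) (hδ1 : δ ≤ 1)
    (hsmall : 2 * ((d : ℝ) + 1) * δ ^ 2 + a * (Real.exp δ - 1) ≤ min 2 a / 2)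
    (S T : Finset ↥R) (hT : T.Nonempty) (ρ : ℝ) (hρ : ∀ x ∈ S, ∀ t ∈ T, ρ ≤ edistR n R x t)
    (g v : ↥R → ℝ) (hg : ∀ x, x ∉ T → g x = 0) (hv : (fineOpR n a 0 R).mulVec v = g) :
    ∑ x ∈ S, v x ^ 2 ≤ (2 / min 2 a) ^ 2 * Real.exp (-(2 * (δ * ρ))) * ∑ x, g x ^ 2 := by
  classical
  have hn0 : (0 : ℝ) < n := by exact_mod_cast hn
  have hn1 : (1 : ℝ) ≤ n := by exact_mod_cast hn
  have hη : (0 : ℝ) < 1 / (n : ℝ) := by positivity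
  have hη1 : 1 / (n : ℝ) ≤ 1 := by rw [div_le_one hn0]; exact hn1
  have hσ : 0 < min 2 a := lt_min (by norm_num) ha
  have hcard : ∀ b : ↥(R.image (blk n)), ((Finset.univ.filter fun i => rblk n R i = b).card : ℝ) = (n : ℝ) ^ (d + 1) := by
    intro b
    rw [card_filter_rblk hn hR b]
    push_cast
    rfl
  refine setDecay_lattice_dist (adjC n R) (adjC_symm n R) (adjC_nonneg n R) (rblk n R)
    (fun b => a / ((Finset.univ.filter fun i => rblk n R i = b).card : ℝ))
    (fun b => div_nonneg ha.le (Nat.cast_nonneg _))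
    (fun b j => if rblk n R j = b then (1 : ℝ) else 0) (fun b j hj => if_neg hj)
    (fineOpR n a 0 R) (fineOpR_zero_eq hn hR a) (min 2 a) hσ (lower18_zero hn ha.le hR)
    (edistR n R) (fun x => by simp [edistR, supNorm_zero']) (fun x y => ?_)
    (fun x y z => ?_) (η := 1 / (n : ℝ)) (δ := δ) (z := 2 * ((d : ℝ) + 1)) (a := a) (D := 1) hη hδ0 ?_ zero_le_one
    (fun j k hjk => ?_) (fun j => card_filter_adjC_ne_zero_le n R j) (fun j k hjk => ?_) (fun b => ?_) ?_
    S T hT ρ hρ g v hg hv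
  · -- symmetry
    simp only [edistR]
    rw [← B4TorusKernel.supNorm_neg, neg_sub]
  · -- triangle inequality
    simp only [edistR]
    rw [← mul_add]
    refine mul_le_mul_of_nonneg_left ?_ hη.le
    have := supNorm_add_le (x.1 - y.1) (y.1 - z.1)
    rwa [sub_add_sub_cancel] at this
  · -- δη ≤ 1
    calc δ * (1 / (n : ℝ)) ≤ 1 * 1 := mul_le_mul hδ1 hη1 hη.le zero_le_one
      _ = 1 := one_mul 1
  · -- bonds: coefficient η⁻² and length ≤ η
    have hadj : k.1 ∈ nbrs j.1 := by
      by_contra h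
      exact hjk (if_neg h)
    refine ⟨?_, ?_⟩
    · simp only [adjC, hadj, if_true]
      field_simp
    · show (1 / (n : ℝ)) * supNorm (j.1 - k.1) ≤ 1 / (n : ℝ)
      calc (1 / (n : ℝ)) * supNorm (j.1 - k.1) ≤ (1 / (n : ℝ)) * 1 :=
            mul_le_mul_of_nonneg_left (supNorm_sub_le_one_of_mem_nbrs hadj) hη.le
        _ = 1 / (n : ℝ) := mul_one _
  · -- blocks have `edistR`-diameter ≤ 1
    have hb : blk n j.1 = blk n k.1 := by
      have := congrArg Subtype.val hjk
      exact this
    show (1 / (n : ℝ)) * supNorm (j.1 - k.1) ≤ 1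
    calc (1 / (n : ℝ)) * supNorm (j.1 - k.1) ≤ (1 / (n : ℝ)) * ((n : ℝ) - 1) :=
          mul_le_mul_of_nonneg_left (supNorm_sub_le_of_blk_eq hn hb) hη.le
      _ ≤ 1 := by rw [div_mul_eq_mul_div, one_mul, div_le_one hn0]; linarith
  · -- block strengths: (a/|B|)·|B| = a
    have hsq : ∑ k : ↥R, (if rblk n R k = b then (1 : ℝ) else 0) ^ 2
        = ((Finset.univ.filter fun i => rblk n R i = b).card : ℝ) := by
      simp_rw [ite_pow, one_pow, zero_pow two_ne_zero]
      rw [Finset.sum_boole]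
    rw [hsq, hcard]
    have hpow : ((n : ℝ) ^ (d + 1)) ≠ 0 := by positivity
    rw [div_mul_cancel₀ a hpow]
  · -- smallness
    simpa [mul_one] using hsmall

/-- **THE GREEN'S FUNCTION VERSION**: with `G = (n²(−Δ^N_R) + (a/n^{d+1})1_{same block})⁻¹` (`= η^{d+1}`-rescaled
`G_k(Ω, 0)`, a genuine inverse by §6) and `g` supported in `T`:
`Σ_{x∈S} (Gg)(x)² ≤ (2/min(2,a))²·e^{−2δ·dist_η(S,T)}·Σ_x g(x)²` — the operator-norm bound
`‖1_S G 1_T‖ ≤ (2/min(2,a))·e^{−δ dist_η(S,T)}`, uniformly in `η` and `Ω`. [cite: CombesThomas1973, §II] [folklore] -/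
theorem green_setDecay_region {n : ℕ} (hn : 1 ≤ n) {R : Finset (Fin (d + 1) → ℤ)} (hR : IsBlockUnion n R)
    {a δ : ℝ} (ha : 0 < a) (hδ0 : 0 ≤ δ) (hδ1 : δ ≤ 1)
    (hsmall : 2 * ((d : ℝ) + 1) * δ ^ 2 + a * (Real.exp δ - 1) ≤ min 2 a / 2)
    (S T : Finset ↥R) (hT : T.Nonempty) (ρ : ℝ) (hρ : ∀ x ∈ S, ∀ t ∈ T, ρ ≤ edistR n R x t)
    (g : ↥R → ℝ) (hg : ∀ x, x ∉ T → g x = 0) :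
    ∑ x ∈ S, ((fineOpR n a 0 R)⁻¹.mulVec g) x ^ 2
      ≤ (2 / min 2 a) ^ 2 * Real.exp (-(2 * (δ * ρ))) * ∑ x, g x ^ 2 := by
  refine setDecay_region hn hR ha hδ0 hδ1 hsmall S T hT ρ hρ g _ hg ?_
  have hpos : 0 < min 2 a + 0 := by rw [add_zero]; exact lt_min (by norm_num) ha
  rw [Matrix.mulVec_mulVec, fineOpR_mul_inv hn ha.le hpos hR, Matrix.one_mulVec]

/-- **KERNEL DECAY**: the entries of `G = (n²(−Δ^N_R) + (a/n^{d+1})1_{same block})⁻¹` satisfy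
`|G(x, t)| ≤ (2/min(2,a))·e^{−δ·η|x − t|_∞}` for every `0 ≤ δ ≤ 1` with `2(d+1)δ² + a(e^δ − 1) ≤ min(2,a)/2`,
uniformly in the mesh `η = 1/n` and in the region. [cite: CombesThomas1973, §II] [folklore] -/
theorem green_entry_decay_region {n : ℕ} (hn : 1 ≤ n) {R : Finset (Fin (d + 1) → ℤ)} (hR : IsBlockUnion n R)
    {a δ : ℝ} (ha : 0 < a) (hδ0 : 0 ≤ δ) (hδ1 : δ ≤ 1)
    (hsmall : 2 * ((d : ℝ) + 1) * δ ^ 2 + a * (Real.exp δ - 1) ≤ min 2 a / 2) (x t : ↥R) :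
    |(fineOpR n a 0 R)⁻¹ x t| ≤ 2 / min 2 a * Real.exp (-(δ * edistR n R x t)) := by
  classical
  have hσ : 0 < min 2 a := lt_min (by norm_num) ha
  have h := green_setDecay_region hn hR ha hδ0 hδ1 hsmall {x} {t} (Finset.singleton_nonempty t)
    (edistR n R x t) (fun x' hx' t' ht' => by
      rw [Finset.mem_singleton] at hx' ht'
      rw [hx', ht']) (Pi.single t 1) (fun y hy => by
      rw [Finset.mem_singleton] at hy
      simp [hy])
  have hsum : ∑ j : ↥R, (Pi.single t (1 : ℝ) : ↥R → ℝ) j ^ 2 = 1 := by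
    rw [Finset.sum_eq_single t]
    · simp
    · intro j _ hj; simp [hj]
    · intro hk; exact absurd (Finset.mem_univ _) hk
  rw [Finset.sum_singleton, hsum, mul_one, QGQInverse.mulVec_single_one_apply] at h
  have h0 : 0 ≤ 2 / min 2 a * Real.exp (-(δ * edistR n R x t)) := by positivity
  have hsq : ((fineOpR n a 0 R)⁻¹ x t) ^ 2 ≤ (2 / min 2 a * Real.exp (-(δ * edistR n R x t))) ^ 2 := by
    calc ((fineOpR n a 0 R)⁻¹ x t) ^ 2 ≤ (2 / min 2 a) ^ 2 * Real.exp (-(2 * (δ * edistR n R x t))) := h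
      _ = (2 / min 2 a * Real.exp (-(δ * edistR n R x t))) ^ 2 := by
          rw [mul_pow, ← Real.exp_nat_mul]; push_cast; ring_nf
  exact abs_le.2 (abs_le_of_sq_le_sq' hsq h0)

/-- the elementary entry bound from coercivity alone: `|G(x, t)| ≤ 1/(min(2,a) + m²)`. [folklore] -/
theorem green_entry_le {n : ℕ} (hn : 1 ≤ n) {R : Finset (Fin (d + 1) → ℤ)} (hR : IsBlockUnion n R)
    {a : ℝ} (ha : 0 ≤ a) {m2 : ℝ} (hpos : 0 < min 2 a + m2) (x t : ↥R) :
    |(fineOpR n a m2 R)⁻¹ x t| ≤ (min 2 a + m2)⁻¹ :=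
  QGQInverse.inv_entry_le_of_coercive hpos (fineOpR_coercive hn ha m2 hR) x t

/-- Sanity instance (the smallness hypothesis is satisfiable with explicit numbers): in dimension `d + 1 = 4`, at
`a = 1`, mesh `η = 1/8`, `δ = 1/10` (`2·4·(1/10)² + (e^{1/10} − 1) ≤ 0.08 + 0.11 < 1/2`), for EVERY finite
`Ω ⊂ ℤ⁴` of unit labels the kernel of `G_k(Ω, 0)` (lattice units) obeys `|G(x,t)| ≤ 2·e^{−|x − t|_∞/80}`. -/
example (Ω : Finset (Fin 4 → ℤ)) (x t : ↥(fineDom 8 Ω)) :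
    |(fineOpR (d := 3) 8 1 0 (fineDom 8 Ω))⁻¹ x t|
      ≤ 2 / min 2 (1 : ℝ) * Real.exp (-((1 / 10) * edistR 8 (fineDom 8 Ω) x t)) :=
  green_entry_decay_region (d := 3) (by norm_num) (fineDom_isBlockUnion (by norm_num) Ω) one_pos (by norm_num)
    (by norm_num)
    (by
      have h := Real.abs_exp_sub_one_sub_id_le (x := (1 / 10 : ℝ)) (by rw [abs_le]; constructor <;> norm_num)
      have h2 : Real.exp (1 / 10 : ℝ) - 1 ≤ 1 / 10 + (1 / 10) ^ 2 := by
        have := (abs_le.1 h).2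
        linarith
      rw [min_eq_right (by norm_num : (1 : ℝ) ≤ 2)]
      push_cast
      nlinarith [h2])
    x t

end

end Literature.MathematicalPhysics.QuantumFieldTheory.Balaban1983to89.B4Lower18
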